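import Literature.MathematicalPhysics.QuantumFieldTheory.Balaban1983to89.B9Eq325QprimeStarLowerBoundZd

/-!
# `Balaban1983to89.B9Eq319QprimeOntoZd` — [Balaban1985BackgroundPropagators] (3.18)–(3.21) pp. 393–394 «`Q′` IS ONTO» AT THE `ℤᵈ × 𝔸` CARRIER: the multi-level
# averaging `Q′ = (𝟙_{Λ_j}Q′_j(U₀))_{j≤m} : L²(Ω₀, ·) → L²(𝔅, ·)` is SURJECTIVE for EVERY background of units `U₀`, under the one-site block-geometry clause
# `LevelDisjoint L m Λ s` alone (no trace, no unitarity, no finite-dimensionality), and at every cube member of [Balaban1985RegularSpaces] (1.131) with no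
# hypothesis left — the sentence that makes print's `(Q′G′²Q′*)⁻¹` of (3.25) meaningful

statement-level skeleton of published theorems with citation tags; proofs where landed; nothing here is a claim about the
Yang–Mills mass gap

`[Balaban1985BackgroundPropagators]` ("B9", CMP **99** (1985) 389–434) p. 393: *«(Q′(U)λ)(y) = Σ_{x∈B(y)} L⁻ᵈ R(U(Γ_{y,x}))λ(x), (3.18) … Q′_j(U) = Q′(Ūʲ⁻¹)⋯Q′(Ū)Q′(U),
(3.19) … N(Q′) = {λ : Q′λ = 0}, (3.21)»*; p. 394 (3.25) («Rf = (I − G′Q′*(Q′G′²Q′*)⁻¹Q′G′)f»).  The construction: given level data `ψ`, place at the site `x_p ∈ Ω₀`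
owned by each constraint point `p = (j, y)` the fibre element `X_p` with `trIter_j x_p X_p = ψ(p)` (`B9Eq325QprimeSingleSiteZd.trIter_surjective` — every step of the
fibre transport is `L⁻ᵈ` times a conjugation by a unit); by the single-site formula `(Q′_iδ_xX)(y′) = 𝟙[blockMap^[i]x = y′]·trIter_i x X` and the blindness of every other
constraint point to `x_p`, the field `Σ_p δ_{x_p} X_p` averages to `ψ`.  PDF held: `paper:balaban1985-cmp99-background-propagators` pp. 393–394 (re-read 2026-08-28).

CITATION HEADER (lean-in-tree rule).  Cell `pub-ymgap` (YM Track A, D-0062 ∕ D-0149), node N06 = [B9], width seat `pub-ymgap-dag-n06-w4` (g5), CLAIM-4 ∕ INTENT-4.  Inputs BY NAME: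
g2 `B9Eq325QprimeSingleSiteZd` (`blockMapIter`, `trIter`, `trIter_surjective`, `QprimeIter_single`, `LevelDisjoint`), g2 `B9Eq325QGGQInvZd` (`levSupp`, `QprimeVec`,
`QprimeVec_apply_of_mem`), g2 `B9Eq324DeltaPrimeAZd` (`single`, `QprimeLin`), g5 `B9Eq325QprimeStarLowerBoundZd.single_mem_suppSub`, dag-n05-c's
`B8CubeMemberLevelDisjoint.levelDisjoint_of_subset_cubeLamS`, `B9Thm311PosDefOpenZd.cubeMember_Ω0_finite`.

WHAT IS PROVED (kernel, 0 sorry; theorems only — no `def`, `instance`, `notation`).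
* ★★★ `QprimeVec_surjective` (`LevelDisjoint L m Λ s ⟹ Q′` surjective, `L ≠ 0`, EVERY background of units).
* ★★ `QprimeVec_surjective_cubeMember` (at the cube members: `Λ_j = cubeLamS … m j`, `s = □₀`, `L ≤ ρ`, `m ≤ k` — no hypothesis left).

HONEST SCOPE.  Averaging algebra at the `ℤᵈ` carrier; no estimate; count-neutral helper (`--supports` the K1 item of record); N05 ∕ N06 NOT discharged; K1 NOT closed;
one finite `𝕋⁴` programme at fixed `ε`, Bałaban as printed; R4 closes only the conditional finite-`𝕋⁴` rung `BalabanLadder.UV` — nothing continuum ∕ ℝ⁴ ∕ OS ∕ mass gap ∕ Clay.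
Unit `pub-ymgap-dag-n06-w4` (g5), 2026-08-28.
-/

noncomputable section

namespace Literature.MathematicalPhysics.QuantumFieldTheory.Balaban1983to89.B9Eq319QprimeOntoZd

open B7Prop1Explicit
open B7Eq78Linearization (QprimeIter zdBlocking)
open B8Eq119TwistedAxial (bgT)
open B8Eq131CubesAdmissible (cubeFam)
open B8CubeMemberZd (cubeLamS)
open B8LeafModelZd (ZdIdx)
open B8Eq191FlatLettersCubeMember (cubeLamS_finite)
open B9Eq321LandauProjectionZd (suppSub)
open B9Eq324DeltaPrimeAZd (single QprimeLin QprimeLin_apply)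
open B9Eq325QGGQInvZd (levSupp QprimeVec QprimeVec_apply_of_mem)
open B9Eq325QprimeSingleSiteZd (blockMapIter trIter QprimeIter_single LevelDisjoint)
open B9Eq325QprimeStarLowerBoundZd (single_mem_suppSub)
open B8CubeMemberLevelDisjoint (levelDisjoint_of_subset_cubeLamS)
open B9Thm311PosDefOpenZd (cubeMember_Ω0_finite)

-- `Site` alone could resolve to the torus sites of `Setup.lean`; re-export the `ℤ^d` sites of `B7Prop1Explicit`.
export B7Prop1Explicit (Site)

variable {d : ℕ} {𝔸 : Type*} [CStarAlgebra 𝔸] {L : ℕ} [NeZero L] (U₀ : Site d → Fin d → 𝔸ˣ) (m : ℕ) (Λ : ℕ → Finset (Site d)) (s : Finset (Site d))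

/-- ★★★ **«`Q′` IS ONTO»** — for EVERY background of units `U₀` (`L ≠ 0`), under the one-site clause `LevelDisjoint L m Λ s` alone (no trace, no unitarity): given level data
`ψ`, put at the site `x_p ∈ Ω₀` owned by each constraint point `p = (j, y)` the fibre element `X_p` with `trIter_j x_p X_p = ψ(p)` (`trIter_surjective`); by the single-site
formula the field `Σ_p δ_{x_p} X_p` averages to `ψ` (every other constraint point is blind to `x_p`).
[cite: Balaban1985BackgroundPropagators, (3.18)–(3.21) pp.393–394, (3.25) p.394 («(Q′G′²Q′*)⁻¹»), Thm 3.11 p.416] -/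
theorem QprimeVec_surjective (h : LevelDisjoint L m Λ s) : Function.Surjective (QprimeVec (𝔸 := 𝔸) L U₀ m Λ s) := by
  classical
  intro ψ
  -- the owned sites and the fibre elements
  have hch : ∀ p : ℕ × Site d, p.1 ∈ Finset.range (m + 1) ∧ p.2 ∈ Λ p.1 → ∃ x ∈ s, blockMapIter L p.1 x = p.2 ∧
      ∀ i ∈ Finset.range (m + 1), ∀ y' ∈ Λ i, (i, y') ≠ (p.1, p.2) → blockMapIter L i x ≠ y' := fun p hp => h p.1 hp.1 p.2 hp.2
  let site : ℕ × Site d → Site d := fun p =>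
    if hp : p.1 ∈ Finset.range (m + 1) ∧ p.2 ∈ Λ p.1 then Classical.choose (hch p hp) else p.2
  have hsite : ∀ p : ℕ × Site d, (hp : p.1 ∈ Finset.range (m + 1) ∧ p.2 ∈ Λ p.1) → site p ∈ s ∧ blockMapIter L p.1 (site p) = p.2 ∧
      ∀ i ∈ Finset.range (m + 1), ∀ y' ∈ Λ i, (i, y') ≠ (p.1, p.2) → blockMapIter L i (site p) ≠ y' := by
    intro p hp
    have hc := Classical.choose_spec (hch p hp)
    have hs : site p = Classical.choose (hch p hp) := by simp only [site, dif_pos hp]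
    rw [hs]
    exact ⟨hc.1, hc.2.1, hc.2.2⟩
  have hX : ∀ p : ℕ × Site d, ∃ X : 𝔸, trIter L U₀ p.1 (site p) X = (ψ : ℕ × Site d → 𝔸) p :=
    fun p => B9Eq325QprimeSingleSiteZd.trIter_surjective L U₀ (NeZero.ne L) (site p) p.1 ((ψ : ℕ × Site d → 𝔸) p)
  let X : ℕ × Site d → 𝔸 := fun p => Classical.choose (hX p)
  have hXp : ∀ p : ℕ × Site d, trIter L U₀ p.1 (site p) (X p) = (ψ : ℕ × Site d → 𝔸) p := fun p => Classical.choose_spec (hX p)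
  -- the constraint set and the test field
  set B : Finset (ℕ × Site d) := (Finset.range (m + 1)).biUnion fun j => (Λ j).image (Prod.mk j) with hB
  have hmemB : ∀ p : ℕ × Site d, p ∈ B ↔ p.1 ∈ Finset.range (m + 1) ∧ p.2 ∈ Λ p.1 := by
    intro p
    simp only [hB, Finset.mem_biUnion, Finset.mem_image]
    constructor
    · rintro ⟨j, hj, y, hy, rfl⟩
      exact ⟨hj, hy⟩
    · rintro ⟨hj, hy⟩
      exact ⟨p.1, hj, p.2, hy, rfl⟩
  have hfmem : ∀ p ∈ B, single (site p) (X p) ∈ suppSub (𝔸 := 𝔸) s :=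
    fun p hp => single_mem_suppSub (hsite p ((hmemB p).1 hp)).1 (X p)
  let f : suppSub (𝔸 := 𝔸) s := ∑ p ∈ B.attach, ⟨single (site p.1) (X p.1), hfmem p.1 p.2⟩
  refine ⟨f, ?_⟩
  apply Subtype.ext
  funext q
  by_cases hq : q.1 ∈ Finset.range (m + 1) ∧ q.2 ∈ Λ q.1
  · rw [QprimeVec_apply_of_mem L U₀ m Λ s f hq.1 hq.2]
    -- expand the field and the averaging over the finite sum
    have hcoe : (f : Site d → 𝔸) = ∑ p ∈ B.attach, single (site p.1) (X p.1) := by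
      simp only [f, Submodule.coe_sum]
    have hlin : QprimeIter (zdBlocking d L) (bgT L U₀) q.1 (f : Site d → 𝔸) q.2 =
        ∑ p ∈ B.attach, QprimeIter (zdBlocking d L) (bgT L U₀) q.1 (single (site p.1) (X p.1)) q.2 := by
      have h1 := congr_fun (map_sum (QprimeLin L U₀ q.1) (fun p : {x // x ∈ B} => single (site p.1) (X p.1)) B.attach) q.2
      simp only [QprimeLin_apply, Finset.sum_apply] at h1
      rw [hcoe]
      exact h1
    have hatt : ∑ p ∈ B.attach, QprimeIter (zdBlocking d L) (bgT L U₀) q.1 (single (site p.1) (X p.1)) q.2 =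
        ∑ p ∈ B, QprimeIter (zdBlocking d L) (bgT L U₀) q.1 (single (site p) (X p)) q.2 :=
      Finset.sum_attach B (fun p => QprimeIter (zdBlocking d L) (bgT L U₀) q.1 (single (site p) (X p)) q.2)
    -- only the owned site of `q` contributes
    have hqB : q ∈ B := (hmemB q).2 hq
    rw [hlin, hatt, Finset.sum_eq_single_of_mem q hqB fun p hp hpq => ?_]
    · rw [QprimeIter_single L U₀ (site q) (X q) q.1 q.2, if_pos (hsite q hq).2.1, hXp q]
    · have hp' := (hmemB p).1 hp
      have hne : (q.1, q.2) ≠ (p.1, p.2) := fun h' => hpq (Prod.ext (Prod.ext_iff.1 h').1.symm (Prod.ext_iff.1 h').2.symm)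
      rw [QprimeIter_single L U₀ (site p) (X p) q.1 q.2, if_neg ((hsite p hp').2.2 q.1 hq.1 q.2 hq.2 hne)]
  · rw [(QprimeVec L U₀ m Λ s f).2 q hq, ψ.2 q hq]

/-- ★★ **«`Q′` IS ONTO» AT THE CUBE MEMBERS** of [Balaban1985RegularSpaces] (1.131) (`Λ_j = cubeLamS … m j`, `s = □₀`; `L ≤ ρ`, `m ≤ k`), for EVERY background of units:
no hypothesis left (dag-n05-c's `levelDisjoint_of_subset_cubeLamS`). [cite: Balaban1985BackgroundPropagators, (3.18)–(3.21) pp.393–394; Balaban1985RegularSpaces, (1.131) p.99] -/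
theorem QprimeVec_surjective_cubeMember (i : ZdIdx d L) {a : Site d} {Mc ρ : ℕ} (hΩ : i.Ω = cubeFam false L a Mc ρ i.k) (hρ : L ≤ ρ)
    {m : ℕ} (hm : m ≤ i.k) (U₀ : Site d → Fin d → 𝔸ˣ) :
    Function.Surjective
      (QprimeVec (𝔸 := 𝔸) L U₀ m (fun j => (cubeLamS_finite L a Mc ρ i.k m j).toFinset) (cubeMember_Ω0_finite i hΩ).toFinset) := by
  have hL1 : 1 ≤ L := Nat.one_le_iff_ne_zero.2 (NeZero.ne L)
  have hs : cubeFam false L a Mc ρ i.k 0 ⊆ ↑((cubeMember_Ω0_finite i hΩ).toFinset) := by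
    rw [Set.Finite.coe_toFinset, hΩ]
  exact QprimeVec_surjective U₀ m _ _
    (levelDisjoint_of_subset_cubeLamS hL1 a Mc hρ hm (fun j _ y hy => (Set.Finite.mem_toFinset _).1 hy) hs)


end Literature.MathematicalPhysics.QuantumFieldTheory.Balaban1983to89.B9Eq319QprimeOntoZd

end
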